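import Literature.AlgebraicTopology.SingularHomology.EilenbergSteenrod
import Literature.AlgebraicTopology.SingularHomology.ExcisionTheorem
import HarnessLib

/-!
# Singular homology satisfies the excision and homotopy axioms — discharges of
`singularHomologyPretheory.isIso_hₚ_map_of_closure_subset_interior` and
`isHomotopyInvariant_singularHomologyPretheory`

Topic `Literature/AlgebraicTopology/SingularHomology`, sibling proofs file of `EilenbergSteenrod.lean`.
That file packages relative singular homology with coefficients in an `R`-module `M` as a value
`Literature.AlgebraicTopology.SingularHomology.singularHomologyPretheory R M` of Mathlib's
`TopPair.HomologyPretheory` and *states* the Eilenberg–Steenrod axioms for it; the excision axiom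
(S. Eilenberg, N. Steenrod, *Foundations of Algebraic Topology* (1952), Ch. I §3, Axiom 6; for the
singular theory Ch. VII; A. Hatcher, *Algebraic Topology* (2002), Thm. 2.20, p. 119) is the named
fact `singularHomologyPretheory.isIso_hₚ_map_of_closure_subset_interior R M (X := X)`:
if `closure U ⊆ interior A` then the morphism of pairs `(X ∖ U, A ∖ U) ⟶ (X, A)` induces
isomorphisms on `Hₚ i` for all `i` (no openness assumption on `U`, i.e. the strong form that
singular homology enjoys, Hatcher Thm. 2.20).

The excision theorem itself is proved in the tree, in `ExcisionTheorem.lean`, for the relative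
homology groups `Literature.AlgebraicTopology.SingularHomology.relativeSingularHomology R M X A n`
and their induced maps `relativeSingularHomology.map`
(`relativeSingularHomology.isIso_map_of_closure_subset_interior_holds`, Hatcher's proof via
Prop. 2.21, iterated barycentric subdivision, and the algebraic excision step). On pairs
`TopPair.ofSubset A` the pretheory's functor `Hₚ i` *is* `relativeSingularHomology R M X A i` and its
action on a map of pairs `ofSubsetHom f h` *is* `relativeSingularHomology.map R M f h i`, both
definitionally (`singularHomologyPretheory.hₚObjOfSubsetIso := Iso.refl _`,
`singularHomologyPretheory.hₚ_map_ofSubsetHom`, proved by `rfl`), so the discharge is a transport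
along a definitional equality:

* `singularHomologyPretheory.isIso_hₚ_map_of_closure_subset_interior_holds R M :
    singularHomologyPretheory.isIso_hₚ_map_of_closure_subset_interior R M (X := X)` (**discharge**).

This file is kept separate from `EilenbergSteenrod.lean` so that the pretheory itself does not
import the concrete chain-level machinery (`SingularChainsConcrete`, `Subdivision`,
`LocalHomology`, `RelativeCapProduct`) that the proof of excision uses.

## The homotopy axiom

`EilenbergSteenrod.lean` states the homotopy axiom (Eilenberg–Steenrod 1952, Ch. I §3, Axiom 5;
Hatcher 2002, Prop. 2.19, p. 118) as the named fact
`isHomotopyInvariant_singularHomologyPretheory R M :=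
(singularHomologyPretheory R M).IsHomotopyInvariant`: for morphisms of pairs `f g : X ⟶ Y` in
Mathlib's `TopPair` (a pair is an embedding `X.snd ⟶ X.fst` in `TopCat`) and a homotopy of pairs
`F : TopPair.Homotopy f g` (homotopies `F.fst`, `F.snd` on both spaces, compatible with the
embeddings), `Hₚ i f = Hₚ i g`. It is **proved** here
(`isHomotopyInvariant_singularHomologyPretheory_holds`), for all `R`, `M`, all pairs and all
degrees, by the classical reduction of the homotopy axiom for pairs to the absolute homotopy
axiom plus exactness — the argument `RelativeHomotopyInvariance.lean` runs for pairs of subsets,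
here on the category `TopPair`:

* the *cylinder pair* `X ⊗ I := (X.fst ⊗ I, X.snd ⊗ I)` (embedding `X.map ▷ I`; Mathlib's cartesian
  monoidal structure on `TopCat` and the interval object `TopCat.I`), the morphisms of pairs
  `ι₀, ι₁ : X ⟶ X ⊗ I`, the projection `p : X ⊗ I ⟶ X`, and the morphism of pairs
  `h_F : X ⊗ I ⟶ Y` assembled from `F.fst.h`, `F.snd.h` and the compatibility square `F.w`;
* `f = ι₀ ≫ h_F` and `g = ι₁ ≫ h_F` (`TopCat.Homotopy.ι₀_h`, `ι₁_h`), so it suffices that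
  `Hₚ i ι₀ = Hₚ i ι₁`;
* both are sections of `Hₚ i p` (`ιₖ ≫ p = 𝟙`), and **`Hₚ i p` is an isomorphism**
  (`singularHomologyPretheory.isIso_hₚ_map_cylinderFst`): by the five lemma on the long exact
  sequences of the two pairs (`HomologicalComplex.HomologySequence.quasiIso_τ₃` applied to
  `singularRelativeChainsFunctor.shortComplexMap R M p` and the short exact sequences
  `singularRelativeChainsFunctor.shortExact`), since `C_•(Z ⊗ I) ⟶ C_•(Z)` is a
  quasi-isomorphism for every `Z : TopCat` (`isIso_homologyMap_singularChainsFunctor_map_fst`: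
  `Z ⊗ I ⟶ Z` is a homotopy equivalence, and absolute singular homology is homotopy invariant —
  Mathlib's `TopCat.Homotopy.congr_homologyMap_singularChainComplexFunctor`, Hatcher Thm. 2.10 and
  Cor. 2.11);
* hence `Hₚ i ι₀ = (Hₚ i p)⁻¹ = Hₚ i ι₁` and `Hₚ i f = Hₚ i g`.

No definitions are introduced: the cylinder pair and its structure maps are the terms
`TopPair.of (X.map ▷ TopCat.I) _`, `TopPair.ofHom TopCat.ι₀ TopCat.ι₀ _`, … local to the proofs.

## References

* S. Eilenberg, N. Steenrod, *Foundations of Algebraic Topology*, Princeton Mathematical Series 15,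
  Princeton University Press 1952, Ch. I §3 (Axiom 5, homotopy; Axiom 6, excision) and Ch. VII
  (the singular theory). [EilenbergSteenrod1952]
* A. Hatcher, *Algebraic Topology*, CUP 2002, §2.1: Thm. 2.10 and Cor. 2.11 (p. 111), Prop. 2.19
  (p. 118), Thm. 2.20 (p. 119; proof pp. 119–124). [HatcherAT2002]
-/

noncomputable section

open CategoryTheory Limits AlgebraicTopology

universe u v

namespace Literature.AlgebraicTopology.SingularHomology

variable (R : Type v) [CommRing R] (M : Type v) [AddCommGroup M] [Module R M]
variable {X : Type u} [TopologicalSpace X]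

namespace singularHomologyPretheory

/-- **Excision axiom for singular homology, discharged** (Eilenberg–Steenrod 1952, Ch. I §3,
Axiom 6, verified for the singular theory in Ch. VII; Hatcher 2002, Thm. 2.20): for subsets
`A U : Set X` with `closure U ⊆ interior A`, the morphism of pairs `(X ∖ U, A ∖ U) ⟶ (X, A)`
(`X ∖ U` the subtype `↥Uᶜ`, `A ∖ U` the preimage `Subtype.val ⁻¹' A`) induces an isomorphism
`((singularHomologyPretheory R M).Hₚ i).map _` for every `i : ℕ`. Proof: by
`hₚ_map_ofSubsetHom` (a `rfl`) the map is `relativeSingularHomology.map R M (subsetIncl Uᶜ) _ i`,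
an isomorphism by the tree's excision theorem
`relativeSingularHomology.isIso_map_of_closure_subset_interior_holds` (`ExcisionTheorem.lean`,
Hatcher's proof of Thm. 2.20 via Prop. 2.21). [cite: HatcherAT2002, Thm. 2.20] -/
theorem isIso_hₚ_map_of_closure_subset_interior_holds :
    isIso_hₚ_map_of_closure_subset_interior R M (X := X) := by
  intro A U hU i
  rw [hₚ_map_ofSubsetHom]
  exact relativeSingularHomology.isIso_map_of_closure_subset_interior_holds R M X hU i

end singularHomologyPretheory

/-! ### The homotopy axiom -/

open MonoidalCategory in
/-- For a pair `X = (X.snd ⟶ X.fst)` and any space `Z`, the product map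
`X.map ▷ Z : X.snd ⊗ Z ⟶ X.fst ⊗ Z`, `(a, z) ↦ (X.map a, z)`, is again an embedding (a product of
embeddings is an embedding), so that `(X.fst ⊗ Z, X.snd ⊗ Z)` is a pair; used with `Z = TopCat.I`,
the cylinder pair. [folklore] -/
theorem isEmbedding_map_whiskerRight (X : TopPair.{u}) (Z : TopCat.{u}) :
    TopCat.isEmbedding (X.map ▷ Z) :=
  X.isEmbedding_map.prodMap Topology.IsEmbedding.id

open MonoidalCategory in
/-- For every `Z : TopCat`, the projection `Z ⊗ I ⟶ Z` of the cylinder induces isomorphisms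
`Hₖ(Z ⊗ I; M) ⟶ Hₖ(Z; M)` on singular homology: it is a homotopy equivalence with homotopy
inverse `ι₀ : Z ⟶ Z ⊗ I` (`ι₀ ≫ fst = 𝟙` on the nose, and `(s, (z, t)) ↦ (z, s • t)` is a homotopy
from `fst ≫ ι₀` to `𝟙 (Z ⊗ I)`), and homotopic maps induce the same map on singular homology
(Hatcher 2002, Thm. 2.10 and Cor. 2.11, p. 111; in Mathlib
`TopCat.Homotopy.congr_homologyMap_singularChainComplexFunctor`).
[cite: HatcherAT2002, Cor. 2.11] -/
theorem isIso_homologyMap_singularChainsFunctor_map_fst (Z : TopCat.{u}) (k : ℕ) :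
    IsIso (HomologicalComplex.homologyMap
      ((singularChainsFunctor R M).map (CartesianMonoidalCategory.fst Z TopCat.I)) k) := by
  -- the contraction of the cylinder onto its bottom, `(s, (z, t)) ↦ (z, s * t)`
  let G : TopCat.Homotopy (CartesianMonoidalCategory.fst Z TopCat.I ≫ TopCat.ι₀)
      (𝟙 (Z ⊗ TopCat.I)) :=
    { toContinuousMap :=
        (⟨fun sp : unitInterval × (Z × TopCat.I.{u}) ↦
            ((sp.2.1, TopCat.I.homeomorph.symm ⟨(sp.1 : ℝ) * (TopCat.I.homeomorph sp.2.2 : ℝ),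
              unitInterval.mul_mem sp.1.2 (TopCat.I.homeomorph sp.2.2).2⟩) : Z × TopCat.I.{u}),
          by fun_prop⟩ : C(unitInterval × (Z × TopCat.I.{u}), Z × TopCat.I.{u}))
      map_zero_left := fun x ↦ Prod.ext rfl (by
        change TopCat.I.homeomorph.symm _ = (0 : TopCat.I)
        rw [Homeomorph.symm_apply_eq, TopCat.I.homeomorph_zero]
        exact Subtype.ext (zero_mul _))
      map_one_left := fun x ↦ Prod.ext rfl (by
        change TopCat.I.homeomorph.symm _ = x.2
        rw [Homeomorph.symm_apply_eq]
        exact Subtype.ext (one_mul _)) }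
  refine ⟨⟨HomologicalComplex.homologyMap ((singularChainsFunctor R M).map TopCat.ι₀) k, ?_, ?_⟩⟩
  · rw [← HomologicalComplex.homologyMap_comp, ← Functor.map_comp,
      G.congr_homologyMap_singularChainComplexFunctor (ModuleCat.of R (ULift.{u} M)) k,
      CategoryTheory.Functor.map_id, HomologicalComplex.homologyMap_id]
  · rw [← HomologicalComplex.homologyMap_comp, ← Functor.map_comp, TopCat.ι₀_fst,
      CategoryTheory.Functor.map_id, HomologicalComplex.homologyMap_id]

open MonoidalCategory in
/-- The projection `p : (X.fst ⊗ I, X.snd ⊗ I) ⟶ (X.fst, X.snd)` of the *cylinder pair* onto the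
pair induces isomorphisms on relative singular homology `Hₚ i` (the step "`p_*` is an
isomorphism" in the reduction of the homotopy axiom for pairs to the absolute one,
Eilenberg–Steenrod 1952, Ch. I §3): the five lemma
(`HomologicalComplex.HomologySequence.quasiIso_τ₃`) on the map of long exact sequences of the two
pairs induced by `p` (`singularRelativeChainsFunctor.shortComplexMap`), both outer chain maps
`C_•(Z ⊗ I) ⟶ C_•(Z)` being quasi-isomorphisms (`isIso_homologyMap_singularChainsFunctor_map_fst`).
The cylinder pair is the term `TopPair.of (X.map ▷ TopCat.I) _`; no definition is introduced.
[folklore] -/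
theorem singularHomologyPretheory.isIso_hₚ_map_cylinderFst (X : TopPair.{u}) (i : ℕ) :
    IsIso (((singularHomologyPretheory R M).Hₚ i).map
      (TopPair.ofHom (CartesianMonoidalCategory.fst _ _) (CartesianMonoidalCategory.fst _ _)
          (CartesianMonoidalCategory.whiskerRight_fst X.map TopCat.I).symm :
        TopPair.of (X.map ▷ TopCat.I) (isEmbedding_map_whiskerRight X TopCat.I) ⟶ X)) := by
  have h₁ : QuasiIso ((singularChainsFunctor R M).map
      (CartesianMonoidalCategory.fst X.snd TopCat.I)) :=
    ⟨fun k ↦ (quasiIsoAt_iff_isIso_homologyMap _ k).2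
      (isIso_homologyMap_singularChainsFunctor_map_fst R M X.snd k)⟩
  have h₂ : QuasiIso ((singularChainsFunctor R M).map
      (CartesianMonoidalCategory.fst X.fst TopCat.I)) :=
    ⟨fun k ↦ (quasiIsoAt_iff_isIso_homologyMap _ k).2
      (isIso_homologyMap_singularChainsFunctor_map_fst R M X.fst k)⟩
  have h₃ := HomologicalComplex.HomologySequence.quasiIso_τ₃
    (singularRelativeChainsFunctor.shortComplexMap R M
      (TopPair.ofHom (CartesianMonoidalCategory.fst _ _) (CartesianMonoidalCategory.fst _ _)
          (CartesianMonoidalCategory.whiskerRight_fst X.map TopCat.I).symm :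
        TopPair.of (X.map ▷ TopCat.I) (isEmbedding_map_whiskerRight X TopCat.I) ⟶ X))
    (singularRelativeChainsFunctor.shortExact R M _)
    (singularRelativeChainsFunctor.shortExact R M X) h₁ h₂
  exact (quasiIsoAt_iff_isIso_homologyMap _ i).1 (h₃.quasiIsoAt i)

open MonoidalCategory in
/-- **Homotopy axiom for singular homology, discharged** (Eilenberg–Steenrod 1952, Ch. I §3,
Axiom 5, verified for the singular theory in Ch. VII; Hatcher 2002, Prop. 2.19, p. 118): homotopic
morphisms of pairs `f g : X ⟶ Y` in `TopPair` — a `TopPair.Homotopy f g`, i.e. homotopies `F.fst` on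
the total spaces and `F.snd` on the subspaces compatible with the embeddings — induce the same map
`((singularHomologyPretheory R M).Hₚ i).map f = ((singularHomologyPretheory R M).Hₚ i).map g` on
relative singular homology with coefficients in `M`, for every `i : ℕ`; i.e. Mathlib's class
`TopPair.HomologyPretheory.IsHomotopyInvariant` holds for `singularHomologyPretheory R M`. Proof:
with the cylinder pair `X ⊗ I := TopPair.of (X.map ▷ I) _` one has `f = ι₀ ≫ h_F` and
`g = ι₁ ≫ h_F` for the morphism of pairs `h_F : X ⊗ I ⟶ Y` given by `(F.fst.h, F.snd.h, F.w)`, and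
`Hₚ i ι₀ = Hₚ i ι₁` because both are sections of the isomorphism `Hₚ i (X ⊗ I ⟶ X)`
(`singularHomologyPretheory.isIso_hₚ_map_cylinderFst`). [cite: HatcherAT2002, Prop. 2.19] -/
theorem isHomotopyInvariant_singularHomologyPretheory_holds :
    isHomotopyInvariant_singularHomologyPretheory.{u, v} R M := by
  show (singularHomologyPretheory R M).IsHomotopyInvariant
  constructor
  intro X Y f g F i
  -- the cylinder pair `P = (X.fst ⊗ I, X.snd ⊗ I)` and its structure maps `ι₀, ι₁, p`, and `h_F`
  let P : TopPair.{u} := TopPair.of (X.map ▷ TopCat.I) (isEmbedding_map_whiskerRight X TopCat.I)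
  let ι₀' : X ⟶ P := TopPair.ofHom TopCat.ι₀ TopCat.ι₀ (TopCat.ι₀_comp X.map)
  let ι₁' : X ⟶ P := TopPair.ofHom TopCat.ι₁ TopCat.ι₁ (TopCat.ι₁_comp X.map)
  let p : P ⟶ X :=
    TopPair.ofHom (CartesianMonoidalCategory.fst _ _) (CartesianMonoidalCategory.fst _ _)
      (CartesianMonoidalCategory.whiskerRight_fst X.map TopCat.I).symm
  let h : P ⟶ Y := TopPair.ofHom F.fst.h F.snd.h F.w.symm
  have hf : f = ι₀' ≫ h := MorphismProperty.Arrow.Hom.ext F.snd.ι₀_h.symm F.fst.ι₀_h.symm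
  have hg : g = ι₁' ≫ h := MorphismProperty.Arrow.Hom.ext F.snd.ι₁_h.symm F.fst.ι₁_h.symm
  have h₀ : ι₀' ≫ p = 𝟙 X := MorphismProperty.Arrow.Hom.ext (TopCat.ι₀_fst _) (TopCat.ι₀_fst _)
  have h₁ : ι₁' ≫ p = 𝟙 X := MorphismProperty.Arrow.Hom.ext (TopCat.ι₁_fst _) (TopCat.ι₁_fst _)
  haveI : IsIso (((singularHomologyPretheory R M).Hₚ i).map p) :=
    singularHomologyPretheory.isIso_hₚ_map_cylinderFst R M X i
  have key : ((singularHomologyPretheory R M).Hₚ i).map ι₀' =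
      ((singularHomologyPretheory R M).Hₚ i).map ι₁' := by
    rw [← cancel_mono (((singularHomologyPretheory R M).Hₚ i).map p), ← Functor.map_comp,
      ← Functor.map_comp, h₀, h₁]
  rw [hf, hg, Functor.map_comp, Functor.map_comp, key]

end Literature.AlgebraicTopology.SingularHomology

end
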